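import Mathlib
import Summits.NavierStokesRegularity.NavierStokesRegularity.Theorems.EulerZoomLiouvillePowerGaugeEulerLiouvilleDSSVorticityDecay
import HarnessLib

/-!
# The DSS vorticity-decay stratum of the crux `EulerZoomLiouville.PowerGaugeEulerLiouville` — far-field
# hypotheses from DECAY OF `∇u` AT SPATIAL INFINITY on one period (route №10, item stmt-NavierStokesRegularity-19832)

Helper file (theorems only; `--supports stmt-NavierStokesRegularity-19832`). Seat ns-typeII-p3 (cell
ns-regularity-ideate §B, D-0081). Sequel of `…DSSVorticityDecay.lean`: the scale-invariant far-field
hypotheses there (`|τ| ‖∇u(τ,y)‖ ≤ δ` and `|τ| |u(τ,y)| ≤ |y|/(2+ρ)` for `|y| ≥ R₀|τ|^{1/(2+ρ)}`, all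
`τ < 0`) follow, for a DSS member, from data on ONE period `P = [l^{2+ρ}τ⋆, τ⋆]`: boundedness of `u` on `P`
and UNIFORM DECAY of `∇u(τ, ·)` at spatial infinity for `τ ∈ P` (`farField_of_dss`; the `ℕ`-step scaling
law `dss_iterate`, its gradient form, and the fundamental-domain lemma `exists_dss_conjugate`). Hence
(`ae_eq_zero_of_gauge_of_dss_gradDecay`, binder form `powerGaugeEulerLiouville_dss_gradDecay`) the
Chae–Tsai form of the stratum: «a classical DSS member (factor `l > 1`) of the class with bounded `u, ∇u`
on compact time intervals, `∇u → 0` at spatial infinity uniformly on one period, and `∫|curl u(τ)|^q`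
bounded on compact time intervals for ONE `q ∈ (0, 3/(2+ρ))`, is trivial» — every `ρ > 0`, no symmetry
(Chae–Tsai, MRL 21 (2014) Thm 2.2: there for `C²ₓC¹ₜ` time-periodic profiles with `|V| + |∇V| → 0`,
closed by the harmonic Liouville theorem; here the `A`-gauge Liouville of the class closes).

WHAT THIS IS NOT: not NS, not the crux E, not rung C2 whole — members with the natural vorticity tail
`|curl u| ~ |y|^{−(2+ρ)}` (no `q < 3/(2+ρ)` is integrable) and non-classical members are untouched. [folklore]
-/

noncomputable section

-- the summit and its single problem share the name `NavierStokesRegularity` (D-0017 nested layout)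
set_option linter.dupNamespace false

open Set Function Filter Topology MeasureTheory Metric Module
open scoped NNReal ENNReal InnerProductSpace RealInnerProductSpace

namespace Summit.NavierStokesRegularity.NavierStokesRegularity.Theorems.PowerGaugeEulerLiouville.VorticityDecay

open Literature.Analysis Literature.Analysis.FluidPDE
open Summit.NavierStokesRegularity.NavierStokesRegularity.Theorems.PowerGaugeEulerLiouville
open Summit.NavierStokesRegularity.NavierStokesRegularity.Theorems.PowerGaugeEulerLiouville.AxisymNoSwirl
open Summit.NavierStokesRegularity.NavierStokesRegularity.Theorems.PowerGaugeEulerLiouville.VorticitySupport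

section FarField

variable {ρ l : ℝ} {u : ℝ → (EuclideanSpace ℝ (Fin 3)) → (EuclideanSpace ℝ (Fin 3))}

/-- **Iterated class scaling**: `u(τ, y) = (l^{1+ρ})^k u((l^{2+ρ})^k τ, l^k y)` for every `k : ℕ`. [folklore] -/
theorem dss_iterate (hl : 0 < l)
    (hdss : ∀ τ : ℝ, τ < 0 → ∀ y, u τ y = (l ^ (1 + ρ)) • u ((l ^ (2 + ρ)) * τ) (l • y))
    (k : ℕ) {τ : ℝ} (hτ : τ < 0) (y : EuclideanSpace ℝ (Fin 3)) :
    u τ y = ((l ^ (1 + ρ)) ^ k) • u ((l ^ (2 + ρ)) ^ k * τ) (l ^ k • y) := by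
  induction k generalizing τ y with
  | zero => simp
  | succ k ih =>
    have hL : 0 < l ^ (2 + ρ) := Real.rpow_pos_of_pos hl _
    have hτ' : l ^ (2 + ρ) * τ < 0 := mul_neg_of_pos_of_neg hL hτ
    rw [hdss τ hτ y, ih hτ' (l • y), smul_smul, smul_smul]
    have e1 : l ^ (1 + ρ) * (l ^ (1 + ρ)) ^ k = (l ^ (1 + ρ)) ^ (k + 1) := by ring
    have e2 : (l ^ (2 + ρ)) ^ k * (l ^ (2 + ρ) * τ) = (l ^ (2 + ρ)) ^ (k + 1) * τ := by ring
    have e3 : l ^ k * l = l ^ (k + 1) := by ring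
    rw [e1, e2, e3]

/-- **Gradient form of the iterated scaling**:
`∇u(τ)(y) = (l^{1+ρ})^k l^k · ∇u((l^{2+ρ})^k τ)(l^k y)` (`u((l^{2+ρ})^k τ)` differentiable). [folklore] -/
theorem fderiv_dss_iterate (hl : 0 < l)
    (hdss : ∀ τ : ℝ, τ < 0 → ∀ y, u τ y = (l ^ (1 + ρ)) • u ((l ^ (2 + ρ)) * τ) (l • y))
    (k : ℕ) {τ : ℝ} (hτ : τ < 0) (hd : Differentiable ℝ (u ((l ^ (2 + ρ)) ^ k * τ)))
    (y : EuclideanSpace ℝ (Fin 3)) :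
    fderiv ℝ (u τ) y = ((l ^ (1 + ρ)) ^ k * l ^ k) • fderiv ℝ (u ((l ^ (2 + ρ)) ^ k * τ)) (l ^ k • y) := by
  have hfun : u τ = fun z => ((l ^ (1 + ρ)) ^ k) • u ((l ^ (2 + ρ)) ^ k * τ) (l ^ k • z) :=
    funext fun z => dss_iterate hl hdss k hτ z
  rw [hfun]
  exact fderiv_smul_comp_smul _ _ (hd _)

/-- **Fundamental domain**: every `τ < 0` is conjugate under an `ℕ`-power of the period map
`τ ↦ l^{2+ρ} τ` (in one direction or the other) to a time of the period `[l^{2+ρ}τ⋆, τ⋆]` (`τ⋆ < 0`,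
`l^{2+ρ} > 1`). [folklore] -/
theorem exists_dss_conjugate {L τs : ℝ} (hL : 1 < L) (hτs : τs < 0) {τ : ℝ} (hτ : τ < 0) :
    ∃ k : ℕ, ∃ τ' ∈ Icc (L * τs) τs, τ = L ^ k * τ' ∨ τ' = L ^ k * τ := by
  have hL0 : 0 < L := zero_lt_one.trans hL
  by_cases h1 : 1 ≤ τ / τs
  · -- `τ` is earlier than `τ⋆`: `τ = L^m τ'` with `τ' = (τ/τ⋆)/L^m · τ⋆`
    obtain ⟨m, hm1, hm2⟩ := exists_nat_pow_near h1 hL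
    have hLm : 0 < L ^ m := pow_pos hL0 m
    have hr1 : 1 ≤ τ / τs / L ^ m := (one_le_div hLm).2 hm1
    have hr2 : τ / τs / L ^ m ≤ L := by
      rw [div_le_iff₀ hLm]; rw [pow_succ] at hm2; linarith
    refine ⟨m, τ / τs / L ^ m * τs, ⟨?_, ?_⟩, Or.inl ?_⟩
    · exact mul_le_mul_of_nonpos_right hr2 hτs.le
    · exact mul_le_of_one_le_left hτs.le hr1
    · have hτs0 : τs ≠ 0 := hτs.ne
      field_simp
  · -- `τ` is later than `τ⋆`: `τ' = L^{m+1} τ ∈ [L τ⋆, τ⋆]`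
    have hx1 : 1 ≤ τs / τ := by
      rw [le_div_iff_of_neg hτ, one_mul]
      rw [not_le, div_lt_one_of_neg hτs] at h1
      exact h1.le
    obtain ⟨m, hm1, hm2⟩ := exists_nat_pow_near hx1 hL
    have e : τs / τ * τ = τs := div_mul_cancel₀ τs hτ.ne
    refine ⟨m + 1, L ^ (m + 1) * τ, ⟨?_, ?_⟩, Or.inr rfl⟩
    · have h2 : L ^ (m + 1) ≤ L * (τs / τ) := by
        rw [pow_succ, mul_comm]; exact mul_le_mul_of_nonneg_left hm1 hL0.le
      have h3 := mul_le_mul_of_nonpos_right h2 hτ.le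
      calc L * τs = L * (τs / τ) * τ := by rw [mul_assoc, e]
        _ ≤ L ^ (m + 1) * τ := h3
    · calc L ^ (m + 1) * τ ≤ τs / τ * τ := mul_le_mul_of_nonpos_right hm2.le hτ.le
        _ = τs := e

/-- Rescaling identities of the class scaling at the `k`-th iterate (`l > 0`, `n = 1/(2+ρ)`):
`((l^{2+ρ})^k)^n = l^k`, `(l^{1+ρ})^k l^k = (l^{2+ρ})^k`. [folklore] -/
theorem dss_power_identities (hρ : 0 < 2 + ρ) (hl : 0 < l) (k : ℕ) :
    ((l ^ (2 + ρ)) ^ k) ^ (2 + ρ)⁻¹ = l ^ k ∧ (l ^ (1 + ρ)) ^ k * l ^ k = (l ^ (2 + ρ)) ^ k := by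
  have hL : 0 ≤ l ^ (2 + ρ) := (Real.rpow_pos_of_pos hl _).le
  refine ⟨?_, ?_⟩
  · rw [← Real.rpow_natCast (l ^ (2 + ρ)) k, ← Real.rpow_mul hL, ← Real.rpow_mul hl.le,
      show (2 + ρ) * ((k : ℝ) * (2 + ρ)⁻¹) = (k : ℝ) by field_simp, Real.rpow_natCast]
  · rw [← mul_pow, ← Real.rpow_add_one hl.ne']
    ring_nf

/-- **Far-field hypotheses from decay on one period.** For a DSS classical Euler flow (factor `l > 1`)
which is bounded on the period `P = [l^{2+ρ}τ⋆, τ⋆]` and whose velocity GRADIENT tends to `0` at spatial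
infinity uniformly on `P`, and every `δ > 0`, there is `R₀ > 0` with the scale-invariant far-field bounds
`|τ| ‖∇u(τ,y)‖ ≤ δ` and `|τ| |u(τ,y)| ≤ |y|/(2+ρ)` for all `τ < 0`, `|y| ≥ R₀ |τ|^{1/(2+ρ)}`
(log-periodicity of the scale-invariant quantities + a fundamental domain). [folklore] -/
theorem farField_of_dss (hρ : 0 < ρ) {p : ℝ → (EuclideanSpace ℝ (Fin 3)) → ℝ}
    (hns : IsClassicalNSSolutionOn (Iio 0) 0 0 u p) (hl : 1 < l)
    (hdss : ∀ τ : ℝ, τ < 0 → ∀ y, u τ y = (l ^ (1 + ρ)) • u ((l ^ (2 + ρ)) * τ) (l • y))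
    {τs : ℝ} (hτs : τs < 0) {B : ℝ} (hB : ∀ τ ∈ Icc (l ^ (2 + ρ) * τs) τs, ∀ y, ‖u τ y‖ ≤ B)
    (hdec : ∀ η : ℝ, 0 < η → ∃ R : ℝ, ∀ τ ∈ Icc (l ^ (2 + ρ) * τs) τs, ∀ y : EuclideanSpace ℝ (Fin 3),
      R ≤ ‖y‖ → ‖fderiv ℝ (u τ) y‖ ≤ η)
    {δ : ℝ} (hδ : 0 < δ) :
    ∃ R₀ : ℝ, 0 < R₀ ∧ ∀ τ : ℝ, τ < 0 → ∀ y : EuclideanSpace ℝ (Fin 3), R₀ * (-τ) ^ (2 + ρ)⁻¹ ≤ ‖y‖ →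
      (-τ) * ‖fderiv ℝ (u τ) y‖ ≤ δ ∧ (-τ) * ‖u τ y‖ ≤ (2 + ρ)⁻¹ * ‖y‖ := by
  have hρ2 : 0 < 2 + ρ := by linarith
  have hl0 : 0 < l := zero_lt_one.trans hl
  set L : ℝ := l ^ (2 + ρ) with hLdef
  have hL1 : 1 < L := Real.one_lt_rpow hl (by linarith)
  have hL0 : 0 < L := zero_lt_one.trans hL1
  set n : ℝ := (2 + ρ)⁻¹ with hndef
  have hn0 : 0 < n := inv_pos.2 hρ2
  have hτs' : 0 < -τs := by linarith
  -- the radius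
  obtain ⟨R, hR⟩ := hdec (δ / (L * (-τs))) (by positivity)
  set Bp : ℝ := max B 0 with hBp
  have hB0 : 0 ≤ Bp := le_max_right _ _
  set R₀ : ℝ := max R 1 / (-τs) ^ n + L * (-τs) * Bp * (2 + ρ) / (-τs) ^ n with hR₀def
  have hsn : 0 < (-τs) ^ n := Real.rpow_pos_of_pos hτs' _
  have hR₀1 : max R 1 / (-τs) ^ n ≤ R₀ := by
    rw [hR₀def]; exact le_add_of_nonneg_right (by positivity)
  have hR₀2 : L * (-τs) * Bp * (2 + ρ) / (-τs) ^ n ≤ R₀ := by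
    rw [hR₀def]; exact le_add_of_nonneg_left (by positivity)
  have hR₀0 : 0 < R₀ := lt_of_lt_of_le (by positivity) hR₀1
  refine ⟨R₀, hR₀0, ?_⟩
  -- base case: times of the period
  have hbase : ∀ τ ∈ Icc (L * τs) τs, ∀ y : EuclideanSpace ℝ (Fin 3), R₀ * (-τ) ^ n ≤ ‖y‖ →
      (-τ) * ‖fderiv ℝ (u τ) y‖ ≤ δ ∧ (-τ) * ‖u τ y‖ ≤ n * ‖y‖ := by
    intro τ hτ y hy
    have hτ0 : 0 < -τ := by linarith [hτ.2]
    have hτL : -τ ≤ L * (-τs) := by linarith [hτ.1]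
    have hmono : (-τs) ^ n ≤ (-τ) ^ n := Real.rpow_le_rpow hτs'.le (by linarith [hτ.2]) hn0.le
    have hy1 : R₀ * (-τs) ^ n ≤ ‖y‖ := (mul_le_mul_of_nonneg_left hmono hR₀0.le).trans hy
    refine ⟨?_, ?_⟩
    · have hyR : R ≤ ‖y‖ := by
        have : max R 1 ≤ R₀ * (-τs) ^ n := by rw [← div_le_iff₀ hsn]; exact hR₀1
        exact (le_max_left _ _).trans (this.trans hy1)
      have h1 := hR τ hτ y hyR
      calc (-τ) * ‖fderiv ℝ (u τ) y‖ ≤ (L * (-τs)) * (δ / (L * (-τs))) :=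
            mul_le_mul hτL h1 (norm_nonneg _) (by positivity)
        _ = δ := by have hτsne : τs ≠ 0 := hτs.ne; field_simp
    · have h1 : ‖u τ y‖ ≤ Bp := (hB τ hτ y).trans (le_max_left _ _)
      have h2 : L * (-τs) * Bp * (2 + ρ) ≤ R₀ * (-τs) ^ n := by rw [← div_le_iff₀ hsn]; exact hR₀2
      calc (-τ) * ‖u τ y‖ ≤ (L * (-τs)) * Bp := mul_le_mul hτL h1 (norm_nonneg _) (by positivity)
        _ = n * (L * (-τs) * Bp * (2 + ρ)) := by rw [hndef]; field_simp
        _ ≤ n * (R₀ * (-τs) ^ n) := mul_le_mul_of_nonneg_left h2 hn0.le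
        _ ≤ n * ‖y‖ := mul_le_mul_of_nonneg_left hy1 hn0.le
  -- general `τ < 0`: conjugate into the period
  intro τ hτ y hy
  have hτ0 : 0 < -τ := by linarith
  obtain ⟨k, τ', hτ'P, hconj⟩ := exists_dss_conjugate hL1 hτs hτ
  have hτ'0 : τ' < 0 := hτ'P.2.trans_lt hτs
  obtain ⟨hpow1, hpow2⟩ := dss_power_identities (l := l) hρ2 hl0 k
  have hlk : 0 < l ^ k := pow_pos hl0 k
  have hLk : 0 < L ^ k := pow_pos hL0 k
  rcases hconj with h | h
  · -- `τ = L^k τ'`: evaluate the iterated scaling at `(τ', l^{-k} y)`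
    set y' : EuclideanSpace ℝ (Fin 3) := (l ^ k)⁻¹ • y with hy'
    have hyy' : l ^ k • y' = y := by rw [hy', smul_smul, mul_inv_cancel₀ hlk.ne', one_smul]
    have hτeq : L ^ k * τ' = τ := by rw [h]
    have hnorm : ‖y'‖ = (l ^ k)⁻¹ * ‖y‖ := by rw [hy', norm_smul, Real.norm_of_nonneg (inv_nonneg.2 hlk.le)]
    have hneg : -τ = L ^ k * (-τ') := by rw [h]; ring
    have hrad : (-τ) ^ n = l ^ k * (-τ') ^ n := by
      rw [hneg, Real.mul_rpow hLk.le (by linarith), hpow1]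
    -- region for `(τ', y')`
    have hy'far : R₀ * (-τ') ^ n ≤ ‖y'‖ := by
      rw [hnorm, le_inv_mul_iff₀ hlk]
      calc l ^ k * (R₀ * (-τ') ^ n) = R₀ * (-τ) ^ n := by rw [hrad]; ring
        _ ≤ ‖y‖ := hy
    obtain ⟨hg, hv⟩ := hbase τ' hτ'P y' hy'far
    have hiter := dss_iterate hl0 hdss k hτ'0 y'
    rw [hyy', hτeq] at hiter
    have hd : Differentiable ℝ (u (L ^ k * τ')) := by
      rw [hτeq]; exact (hns.contDiff_velocity hτ).differentiable (by simp)
    have hD := fderiv_dss_iterate hl0 hdss k hτ'0 hd y'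
    rw [hyy', hτeq] at hD
    refine ⟨?_, ?_⟩
    · -- gradient: `‖∇u(τ')(y')‖ = L^k ‖∇u(τ)(y)‖`
      have e : ‖fderiv ℝ (u τ') y'‖ = L ^ k * ‖fderiv ℝ (u τ) y‖ := by
        rw [hD, norm_smul, Real.norm_of_nonneg (by positivity), hpow2]
      calc (-τ) * ‖fderiv ℝ (u τ) y‖ = (-τ') * ‖fderiv ℝ (u τ') y'‖ := by rw [e, hneg]; ring
        _ ≤ δ := hg
    · -- velocity: `‖u τ' y'‖ = (l^{1+ρ})^k ‖u τ y‖`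
      have hc : 0 < (l ^ (1 + ρ)) ^ k := pow_pos (Real.rpow_pos_of_pos hl0 _) k
      have e : ‖u τ' y'‖ = (l ^ (1 + ρ)) ^ k * ‖u τ y‖ := by
        rw [hiter, norm_smul, Real.norm_of_nonneg hc.le]
      have e2 : (-τ) * ‖u τ y‖ = l ^ k * ((-τ') * ‖u τ' y'‖) := by
        rw [e, hneg, ← hpow2]; field_simp
      rw [e2]
      calc l ^ k * ((-τ') * ‖u τ' y'‖) ≤ l ^ k * (n * ‖y'‖) := mul_le_mul_of_nonneg_left hv hlk.le
        _ = n * ‖y‖ := by rw [hnorm]; field_simp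
  · -- `τ' = L^k τ`: evaluate the iterated scaling at `(τ, y)`
    set y' : EuclideanSpace ℝ (Fin 3) := l ^ k • y with hy'
    have hnorm : ‖y'‖ = l ^ k * ‖y‖ := by rw [hy', norm_smul, Real.norm_of_nonneg hlk.le]
    have hneg : -τ' = L ^ k * (-τ) := by rw [h]; ring
    have hrad : (-τ') ^ n = l ^ k * (-τ) ^ n := by
      rw [hneg, Real.mul_rpow hLk.le hτ0.le, hpow1]
    have hy'far : R₀ * (-τ') ^ n ≤ ‖y'‖ := by
      rw [hnorm, hrad]
      calc R₀ * (l ^ k * (-τ) ^ n) = l ^ k * (R₀ * (-τ) ^ n) := by ring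
        _ ≤ l ^ k * ‖y‖ := mul_le_mul_of_nonneg_left hy hlk.le
    obtain ⟨hg, hv⟩ := hbase τ' hτ'P y' hy'far
    have hiter := dss_iterate hl0 hdss k hτ y
    rw [← h] at hiter
    have hd : Differentiable ℝ (u (L ^ k * τ)) := by
      rw [← h]; exact (hns.contDiff_velocity hτ'0).differentiable (by simp)
    have hD := fderiv_dss_iterate hl0 hdss k hτ hd y
    rw [← h] at hD
    refine ⟨?_, ?_⟩
    · have e : ‖fderiv ℝ (u τ) y‖ = L ^ k * ‖fderiv ℝ (u τ') y'‖ := by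
        rw [hD, hy', norm_smul, Real.norm_of_nonneg (by positivity), hpow2]
      calc (-τ) * ‖fderiv ℝ (u τ) y‖ = (-τ') * ‖fderiv ℝ (u τ') y'‖ := by rw [e, hneg]; ring
        _ ≤ δ := hg
    · have hc : 0 < (l ^ (1 + ρ)) ^ k := pow_pos (Real.rpow_pos_of_pos hl0 _) k
      have e : ‖u τ y‖ = (l ^ (1 + ρ)) ^ k * ‖u τ' y'‖ := by
        rw [hiter, hy', norm_smul, Real.norm_of_nonneg hc.le]
      have e2 : l ^ k * ((-τ) * ‖u τ y‖) = (-τ') * ‖u τ' y'‖ := by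
        rw [e, hneg, ← hpow2]; ring
      have h3 : l ^ k * ((-τ) * ‖u τ y‖) ≤ l ^ k * (n * ‖y‖) := by
        rw [e2]
        calc (-τ') * ‖u τ' y'‖ ≤ n * ‖y'‖ := hv
          _ = l ^ k * (n * ‖y‖) := by rw [hnorm]; ring
      exact le_of_mul_le_mul_left h3 hlk

/-- **The DSS stratum of the crux with GRADIENT DECAY AT INFINITY (Chae–Tsai form).** A member of the
power-gauged class (`ρ > 0`, the crux's hypotheses verbatim) that is classical on the open slab, DSS with
factor `l > 1`, with bounded `u, ∇u` and bounded `∫|curl u(τ)|^q` on compact time intervals for ONE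
exponent `0 < q < 3/(2+ρ)`, and whose velocity gradient tends to `0` at spatial infinity uniformly on one
period `[l^{2+ρ}τ⋆, τ⋆]`, vanishes a.e. — every `ρ > 0`, no symmetry. [folklore] -/
theorem ae_eq_zero_of_gauge_of_dss_gradDecay (hρ : 0 < ρ)
    {p : ℝ → (EuclideanSpace ℝ (Fin 3)) → ℝ}
    {H : ℝ → (EuclideanSpace ℝ (Fin 3)) → (EuclideanSpace ℝ (Fin 3)) →L[ℝ] (EuclideanSpace ℝ (Fin 3))} {c : ℝ≥0}
    (hH : HasWeakSpatialGradientOn (slab (EuclideanSpace ℝ (Fin 3)) (Iio 0) isOpen_Iio) u H)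
    (hc : ∀ a : ℝ, 0 < a → ENNReal.ofReal (a ^ (2 * ρ)) * cknA a (0 : ℝ × (EuclideanSpace ℝ (Fin 3))) u +
        ENNReal.ofReal (a ^ ρ) * cknE a (0 : ℝ × (EuclideanSpace ℝ (Fin 3))) H +
        ENNReal.ofReal (a ^ (2 * ρ)) * cknD a (0 : ℝ × (EuclideanSpace ℝ (Fin 3))) p ≤ (c : ℝ≥0∞))
    (hns : IsClassicalNSSolutionOn (Iio 0) 0 0 u p) (hl : 1 < l)
    (hdss : ∀ τ : ℝ, τ < 0 → ∀ y, u τ y = (l ^ (1 + ρ)) • u ((l ^ (2 + ρ)) * τ) (l • y))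
    (hbdd : ∀ s t : ℝ, s < t → t < 0 → ∃ B : ℝ, ∀ τ ∈ Icc s t, ∀ y,
      ‖u τ y‖ ≤ B ∧ ‖fderiv ℝ (u τ) y‖ ≤ B)
    {q : ℝ} (hq : 0 < q) (hq3 : q * (2 + ρ) < 3)
    (hLq : ∀ s t : ℝ, s < t → t < 0 → ∃ N : ℝ, ∀ τ ∈ Icc s t,
      Integrable (fun y => ‖curl (u τ) y‖ ^ q) ∧ ∫ y, ‖curl (u τ) y‖ ^ q ≤ N)
    {τs : ℝ} (hτs : τs < 0)
    (hdec : ∀ η : ℝ, 0 < η → ∃ R : ℝ, ∀ τ ∈ Icc (l ^ (2 + ρ) * τs) τs, ∀ y : EuclideanSpace ℝ (Fin 3),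
      R ≤ ‖y‖ → ‖fderiv ℝ (u τ) y‖ ≤ η) :
    uncurry u =ᵐ[volume.restrict (Iio (0 : ℝ) ×ˢ (univ : Set (EuclideanSpace ℝ (Fin 3))))] 0 := by
  have hl0 : 0 < l := zero_lt_one.trans hl
  have hL1 : 1 < l ^ (2 + ρ) := Real.one_lt_rpow hl (by linarith)
  -- the smallness constant
  set L : ℝ := l ^ (3 - q * (2 + ρ)) with hL
  have hL' : 1 < L := Real.one_lt_rpow hl (by linarith)
  set A : ℝ := q * (l ^ (2 + ρ) - 1) with hA
  have hA0 : 0 ≤ A := mul_nonneg hq.le (by linarith)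
  set δ : ℝ := (1 - L⁻¹) / (2 * (A + 1)) with hδ
  have hLinv : L⁻¹ < 1 := inv_lt_one_of_one_lt₀ hL'
  have hδ0 : 0 < δ := div_pos (by linarith) (by positivity)
  have hsmall : 1 < (1 - q * δ * (l ^ (2 + ρ) - 1)) * l ^ (3 - q * (2 + ρ)) := by
    have e1 : q * δ * (l ^ (2 + ρ) - 1) = A * δ := by rw [hA]; ring
    rw [e1, ← hL]
    have hLpos : 0 < L := by linarith
    have e2 : (1 - A * δ) * L - 1 = (L - 1) * (A + 2) / (2 * (A + 1)) := by
      rw [hδ]; field_simp; ring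
    have h3 : 0 < (L - 1) * (A + 2) / (2 * (A + 1)) := by
      apply div_pos (mul_pos (by linarith) (by linarith)) (by positivity)
    linarith
  -- far-field bounds from the decay on one period
  have hper : l ^ (2 + ρ) * τs < τs := by nlinarith
  obtain ⟨B, hB⟩ := hbdd (l ^ (2 + ρ) * τs) τs hper hτs
  obtain ⟨R₀, hR₀, hfar⟩ := farField_of_dss hρ hns hl hdss hτs (fun τ hτ y => (hB τ hτ y).1) hdec hδ0
  exact ae_eq_zero_of_gauge_of_dss_vorticityDecay hρ hH hc hns hl hdss hbdd hq hR₀ hδ0.le hLq hfar hsmall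

/-- **Binder form**: the crux `PowerGaugeEulerLiouville` VERBATIM with the extra hypotheses «classical on the
open slab, DSS with factor `l > 1`, bounded `u`/`∇u` and bounded `∫|curl u(τ)|^q` on compact time intervals
for one `q ∈ (0, 3/(2+ρ))`, and `∇u(τ, ·) → 0` at spatial infinity uniformly on one period
`[l^{2+ρ}τ⋆, τ⋆]`» — NO symmetry (Chae–Tsai, MRL 21 (2014) Thm 2.2 for Seregin's class). [folklore] -/
theorem powerGaugeEulerLiouville_dss_gradDecay :
    ∀ ρ : ℝ, 0 < ρ → ∀ (u : ℝ → EuclideanSpace ℝ (Fin 3) → EuclideanSpace ℝ (Fin 3))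
      (p : ℝ → EuclideanSpace ℝ (Fin 3) → ℝ)
      (H : ℝ → EuclideanSpace ℝ (Fin 3) → EuclideanSpace ℝ (Fin 3) →L[ℝ] EuclideanSpace ℝ (Fin 3)) (c : ℝ≥0)
      (l q τs : ℝ),
      IsSuitableWeakSolutionOn (slab (EuclideanSpace ℝ (Fin 3)) (Iio 0) isOpen_Iio) 0 0 u p →
      HasWeakSpatialGradientOn (slab (EuclideanSpace ℝ (Fin 3)) (Iio 0) isOpen_Iio) u H →
      (∀ a : ℝ, 0 < a → ENNReal.ofReal (a ^ (2 * ρ)) * cknA a (0 : ℝ × EuclideanSpace ℝ (Fin 3)) u +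
        ENNReal.ofReal (a ^ ρ) * cknE a (0 : ℝ × EuclideanSpace ℝ (Fin 3)) H +
        ENNReal.ofReal (a ^ (2 * ρ)) * cknD a (0 : ℝ × EuclideanSpace ℝ (Fin 3)) p ≤ (c : ℝ≥0∞)) →
      IsClassicalNSSolutionOn (Iio 0) 0 0 u p →
      1 < l →
      (∀ τ : ℝ, τ < 0 → ∀ y, u τ y = (l ^ (1 + ρ)) • u ((l ^ (2 + ρ)) * τ) (l • y)) →
      (∀ s t : ℝ, s < t → t < 0 → ∃ B : ℝ, ∀ τ ∈ Icc s t, ∀ y,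
        ‖u τ y‖ ≤ B ∧ ‖fderiv ℝ (u τ) y‖ ≤ B) →
      0 < q → q * (2 + ρ) < 3 →
      (∀ s t : ℝ, s < t → t < 0 → ∃ N : ℝ, ∀ τ ∈ Icc s t,
        Integrable (fun y => ‖curl (u τ) y‖ ^ q) ∧ ∫ y, ‖curl (u τ) y‖ ^ q ≤ N) →
      τs < 0 →
      (∀ η : ℝ, 0 < η → ∃ R : ℝ, ∀ τ ∈ Icc (l ^ (2 + ρ) * τs) τs, ∀ y : EuclideanSpace ℝ (Fin 3),
        R ≤ ‖y‖ → ‖fderiv ℝ (u τ) y‖ ≤ η) →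
      Function.uncurry u =ᵐ[volume.restrict (Iio (0 : ℝ) ×ˢ (univ : Set (EuclideanSpace ℝ (Fin 3))))] 0 :=
  fun _ hρ _ _ _ _ _ _ _ _ hH hc hns hl hdss hbdd hq hq3 hLq hτs hdec =>
    ae_eq_zero_of_gauge_of_dss_gradDecay hρ hH hc hns hl hdss hbdd hq hq3 hLq hτs hdec

end FarField

end Summit.NavierStokesRegularity.NavierStokesRegularity.Theorems.PowerGaugeEulerLiouville.VorticityDecay

end
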